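import Summits.HodgeConjecture.CorCM.GaloisIndexTwoCyclicTimesTwo
import HarnessLib

/-!
# THE INDEX-TWO WORLD CLASSIFIED (degree `2^n ≥ 128`, unconditional): a GOOD Galois CM `2`-power field with an abelian subgroup of
# index two containing complex conjugation is structured

COR-CM (cell `pub-hodgecm2`), binder seat b04 (gen 35), count-neutral own lane «Galois-CM-type classification».  KERNEL ONLY:
theorems; no definition, no named fact, no `sorry`.  `HC_CM` is neither used nor claimed.

`K` Galois CM of degree `2^n`, GOOD (every primitive CM type nondegenerate); `A ≤ Gal(K/ℚ)` ABELIAN of index `2` with `c ∈ A`.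
`CorCM/GaloisIndexTwoAbelianRank` (`n ≥ 6`): `A` has at most three involutions and no `C₄ × C₄`.  HERE this is turned into

* **`exists_orderOf_eq_of_index_two_abelian`** (`n ≥ 6`) — `A` contains an element of order `2^(n-2) = |A|/2`.  Elementary, without the
  structure theorem of finite abelian groups: the squaring map `a ↦ a²` on `A` is a homomorphism with kernel of order `≤ 4` (the
  involutions), so its image `A²` has order `≥ 2^(n-3)`; any two elements of order `4` in `A` meet non-trivially, hence have the same
  square, so `A²` has at most one involution and is cyclic (gen 34's «unique involution ⟹ cyclic or quaternion»; a commutative group is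
  not quaternion) — a generator `x²` of `A²` gives `x ∈ A` of order `2^(n-2)` or `2^(n-1)`.
* **`struct_of_index_two_abelian'`** (`n ≥ 7`) — with `CorCM/GaloisIndexTwoCyclicTimesTwo`: `Gal(K/ℚ) = H·E`, `H.IsComplement' E`, `E` central
  of exponent `2`, `|E| ≤ 2`, `c ∈ H ∖ E`, `H` cyclic or generalised quaternion — i.e. `Gal(K/ℚ) ∈ {C, Q, C × C₂, Q × C₂}`, the conjectured
  list, now PROVED for every GOOD Galois CM field of degree `2^n ≥ 128` whose Galois group has an abelian subgroup of index two containing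
  complex conjugation; `good_iff_struct_of_index_two_abelian'` — as an equivalence; `hodgeConjectureFor_pow_of_index_two_abelian'` — the
  Hodge conjecture for all powers of all abelian varieties with CM by such a field; **`good_iff_struct_of_index_two_abelian_any`** — the
  equivalence for ANY abelian subgroup of index two (if it misses `c`, the group is abelian and gens 15–16 supply one containing `c`).

## References

* [Rotman1995] J. J. Rotman, *An Introduction to the Theory of Groups*, 4th ed., GTM 148, Springer 1995, Thm. 5.46.
* [Kubota1965] T. Kubota, *On the field extension by complex multiplication*, Trans. AMS 118 (1965), §2 and §4 Lemma 2.
* [Shimura1998] G. Shimura, *Abelian Varieties with Complex Multiplication and Modular Functions*, §8.2 Prop. 26, §18.2.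
* [Gordon1999HodgeAVSurvey] B. B. Gordon, *A survey of the Hodge conjecture for abelian varieties*, Thm. 6.4, §9.3, §9.4.3.
-/

noncomputable section

open CategoryTheory CategoryTheory.Limits NumberField
open scoped BigOperators

namespace Summit.HodgeConjecture.CorCM.GaloisModels

open Literature.NumberTheory.ComplexMultiplication
open Literature.AlgebraicGeometry.Motives (AbelianVariety CMType)
open Literature.AlgebraicGeometry.HodgeTheory
open Literature.AlgebraicGeometry.Pohlmann1968
open Summit.HodgeConjecture.CorCM.GaloisRank

section Group

variable {G : Type*} [Group G]

/-- A generalised quaternion group `QuaternionGroup m`, `m ≥ 2`, is not commutative: `a 1` and `xa 0` do not commute. [folklore] -/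
theorem not_comm_of_mulEquiv_quaternionGroup {m : ℕ} (hm : 2 ≤ m) (e : G ≃* QuaternionGroup m)
    (hcomm : ∀ s t : G, s * t = t * s) : False := by
  haveI : NeZero m := ⟨by omega⟩
  have h := hcomm (e.symm (QuaternionGroup.a 1)) (e.symm (QuaternionGroup.xa 0))
  rw [← map_mul, ← map_mul, e.symm.apply_eq_iff_eq, QuaternionGroup.a_mul_xa, QuaternionGroup.xa_mul_a] at h
  have h2 : (0 : ZMod (2 * m)) - 1 = 0 + 1 := QuaternionGroup.xa.inj h
  have h3 : ((2 : ℕ) : ZMod (2 * m)) = 0 := by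
    have : (1 : ZMod (2 * m)) + 1 = 0 := by
      calc (1 : ZMod (2 * m)) + 1 = (0 + 1) + 1 := by rw [zero_add]
        _ = (0 - 1) + 1 := by rw [← h2]
        _ = 0 := by ring
    exact_mod_cast this
  rw [ZMod.natCast_eq_zero_iff] at h3
  have := Nat.le_of_dvd (by norm_num) h3
  omega

end Group

section Field

variable {K : Type} [Field K] [NumberField K] [IsCMField K] [IsGalois ℚ K]

/-- **An abelian subgroup of index two containing `c` has an element of order `|A|/2`** (GOOD fields of degree `2^n ≥ 64`).  The
squares of `A` form a cyclic group of order `≥ 2^(n-3)` (kernel of squaring = the `≤ 4` involutions of `A`; two elements of order `4`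
meet non-trivially, so all have the same square and `A²` has a unique involution), whose generator is the square of an element of
order `≥ 2^(n-2)`. [cite: Rotman1995, Thm. 5.46] [cite: Shimura1998, §8.2 Prop. 26 and §32.10] [cite: Kubota1965, §2 and §4 Lemma 2] -/
theorem exists_orderOf_eq_of_index_two_abelian {n : ℕ} (hdeg : Module.finrank ℚ K = 2 ^ n) (hn : 6 ≤ n)
    (hgood : ∀ (Φ : CMType K) (φ : K →+* ℂ), IsPrimitive (ℂ ≃+* ℂ) Φ.1 φ → IsNondegenerate Φ)
    (A : Subgroup (K ≃ₐ[ℚ] K)) (hAidx : A.index = 2) (hcommA : ∀ u ∈ A, ∀ v ∈ A, u * v = v * u)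
    (hcA : (IsCMField.complexConj K).restrictScalars ℚ ∈ A) : ∃ g ∈ A, orderOf g = 2 ^ (n - 2) := by
  classical
  set c := (IsCMField.complexConj K).restrictScalars ℚ with hc
  have hcc : c * c = 1 := model_complexConj_mul_self (MulEquiv.refl (K ≃ₐ[ℚ] K)) (by simp [hc])
  have hc1 : c ≠ 1 := model_complexConj_ne_one (MulEquiv.refl (K ≃ₐ[ℚ] K)) (by simp [hc])
  have hcard : Nat.card (K ≃ₐ[ℚ] K) = 2 ^ n := by
    rw [Nat.card_eq_fintype_card, card_model_eq_finrank (MulEquiv.refl (K ≃ₐ[ℚ] K)), hdeg]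
  have hAcard : Nat.card A = 2 ^ (n - 1) := by
    have h1 := A.index_mul_card
    rw [hAidx, hcard, show 2 ^ n = 2 * 2 ^ (n - 1) by rw [← pow_succ', Nat.sub_add_cancel (by omega)]] at h1
    exact Nat.eq_of_mul_eq_mul_left (by norm_num) h1
  have hsq4 : ∀ s : K ≃ₐ[ℚ] K, s ^ 4 = 1 → s * s * (s * s) = 1 := fun s hs => by
    rw [show s * s * (s * s) = s ^ 4 by simp only [pow_succ, pow_zero, one_mul, mul_assoc]]; exact hs
  have hord4 : ∀ s : K ≃ₐ[ℚ] K, s ^ 4 = 1 → s * s ≠ 1 → orderOf s = 2 ^ 2 := fun s hs hs2 =>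
    orderOf_eq_prime_pow (p := 2) (n := 1) (by rw [pow_one, pow_two]; exact hs2)
      (by rw [show 2 ^ (1 + 1) = 4 by norm_num]; exact hs)
  /- Step 1: a subgroup `Ω` of order `≤ 4` containing every involution of `A` -/
  obtain ⟨Ω, hΩcard, hΩ⟩ : ∃ Ω : Subgroup (K ≃ₐ[ℚ] K), Nat.card Ω ≤ 4 ∧ ∀ a ∈ A, a * a = 1 → a ∈ Ω := by
    by_cases hex : ∃ t₁ ∈ A, t₁ * t₁ = 1 ∧ t₁ ≠ 1 ∧ t₁ ≠ c
    · obtain ⟨t₁, ht₁A, ht₁, ht₁1, ht₁c⟩ := hex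
      refine ⟨Subgroup.closure ({t₁, c} : Set (K ≃ₐ[ℚ] K)), ?_, fun a haA haa => ?_⟩
      · have := card_closure_pair_le (a := t₁) (y := c) (hcommA t₁ ht₁A c hcA)
        rw [orderOf_eq_prime (p := 2) (by rw [pow_two, ht₁]) ht₁1, orderOf_eq_prime (p := 2) (by rw [pow_two, hcc]) hc1] at this
        exact this
      · exact mem_closure_of_involutions_of_index_two_abelian hdeg hn hgood A hAidx hcommA hcA t₁ a ht₁A haA ht₁ haa ht₁1 ht₁c
    · push Not at hex
      refine ⟨Subgroup.zpowers c, ?_, fun a haA haa => ?_⟩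
      · rw [Nat.card_zpowers, orderOf_eq_prime (p := 2) (by rw [pow_two, hcc]) hc1]
        norm_num
      · by_cases ha1 : a = 1
        · rw [ha1]; exact Subgroup.one_mem _
        · rw [hex a haA haa ha1]; exact Subgroup.mem_zpowers c
  /- Step 2: the squaring homomorphism `A → Gal`, its kernel (order `≤ 4`) and range `R` (order `2^j ≥ 2^(n-3)`) -/
  let f : A →* (K ≃ₐ[ℚ] K) := MonoidHom.mk' (fun a => (a : K ≃ₐ[ℚ] K) * a) (fun a b => by
    show (a : K ≃ₐ[ℚ] K) * b * (a * b) = a * a * (b * b)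
    rw [show (a : K ≃ₐ[ℚ] K) * b * (a * b) = a * (b * a) * b by group, hcommA b b.2 a a.2]; group)
  have hf : ∀ a : A, f a = (a : K ≃ₐ[ℚ] K) * a := fun a => rfl
  have hker_le : Nat.card f.ker ≤ 4 := by
    refine le_trans (Nat.card_le_card_of_injective (fun a : f.ker => (⟨a.1.1, hΩ _ a.1.2 (by
      have := a.2; rw [MonoidHom.mem_ker, hf] at this; exact this)⟩ : Ω)) fun a b h => ?_) hΩcard
    have h' := congrArg (fun z : Ω => (z : K ≃ₐ[ℚ] K)) h
    simp only at h'
    exact Subtype.ext (Subtype.ext h')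
  set R := f.range with hR
  have hRmem : ∀ y : K ≃ₐ[ℚ] K, y ∈ R → ∃ a ∈ A, a * a = y := fun y hy => by
    obtain ⟨a, ha⟩ := MonoidHom.mem_range.1 hy
    exact ⟨a, a.2, ha⟩
  have hRA : ∀ y : K ≃ₐ[ℚ] K, y ∈ R → y ∈ A := fun y hy => by
    obtain ⟨a, haA, rfl⟩ := hRmem y hy
    exact A.mul_mem haA haA
  have hRcard_mul : Nat.card R * Nat.card f.ker = 2 ^ (n - 1) := by rw [hR, ← Subgroup.index_ker, f.ker.index_mul_card, hAcard]
  obtain ⟨j, -, hj⟩ := (Nat.dvd_prime_pow Nat.prime_two).1 (hcard ▸ R.card_subgroup_dvd_card)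
  have hj3 : n - 3 ≤ j := by
    have hkpos : 0 < Nat.card f.ker := Nat.card_pos
    have h1 : 2 ^ (n - 1) ≤ 2 ^ j * 4 := by
      rw [← hRcard_mul, hj]; exact Nat.mul_le_mul_left _ hker_le
    rw [show 2 ^ (n - 1) = 2 ^ (n - 3) * 4 by rw [show n - 1 = (n - 3) + 2 by omega, pow_add]; norm_num] at h1
    exact (Nat.pow_le_pow_iff_right (by norm_num)).1 (Nat.le_of_mul_le_mul_right h1 (by norm_num))
  /- Step 3: all elements of order `4` of `A` have the same square, so `R` has at most one involution -/
  have hpow4 : ∀ (a : K ≃ₐ[ℚ] K), a ^ 4 = 1 → ∀ w ∈ Subgroup.zpowers a, w ^ 4 = 1 := by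
    intro a ha w hw
    obtain ⟨i, rfl⟩ := Subgroup.mem_zpowers_iff.1 hw
    rw [← zpow_natCast, ← zpow_mul, mul_comm, zpow_mul, show ((4 : ℕ) : ℤ) = 4 by norm_num,
      show a ^ (4 : ℤ) = a ^ (4 : ℕ) by norm_cast, ha, one_zpow]
  have hsame : ∀ a b : K ≃ₐ[ℚ] K, a ∈ A → b ∈ A → a ^ 4 = 1 → a * a ≠ 1 → b ^ 4 = 1 → b * b ≠ 1 → a * a = b * b := by
    intro a b haA hbA ha4 ha2 hb4 hb2
    obtain ⟨w, hw1, hwa, hwb⟩ :=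
      exists_mem_zpowers_of_order_four_of_index_two_abelian hdeg hn hgood A hAidx hcommA hcA a b haA hbA ha4 ha2 hb4 hb2
    have haamem : a * a ∈ Subgroup.zpowers a := Subgroup.mul_mem _ (Subgroup.mem_zpowers a) (Subgroup.mem_zpowers a)
    have hbbmem : b * b ∈ Subgroup.zpowers b := Subgroup.mul_mem _ (Subgroup.mem_zpowers b) (Subgroup.mem_zpowers b)
    by_cases hww : w * w = 1
    · rw [← involution_eq_of_mem_zpowers (hord4 a ha4 ha2) hwa hww hw1 haamem (hsq4 a ha4) ha2,
        ← involution_eq_of_mem_zpowers (hord4 b hb4 hb2) hwb hww hw1 hbbmem (hsq4 b hb4) hb2]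
    · have hw4 : w * w * (w * w) = 1 := hsq4 w (hpow4 a ha4 w hwa)
      rw [← involution_eq_of_mem_zpowers (hord4 a ha4 ha2) (Subgroup.mul_mem _ hwa hwa) hw4 hww haamem (hsq4 a ha4) ha2,
        ← involution_eq_of_mem_zpowers (hord4 b hb4 hb2) (Subgroup.mul_mem _ hwb hwb) hw4 hww hbbmem (hsq4 b hb4) hb2]
  have huniq : ∀ s t : R, s * s = 1 → s ≠ 1 → t * t = 1 → t ≠ 1 → s = t := by
    intro s t hss hs1 htt ht1
    apply Subtype.ext
    obtain ⟨a, haA, ha⟩ := hRmem s s.2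
    obtain ⟨b, hbA, hb⟩ := hRmem t t.2
    have hss' : (s : K ≃ₐ[ℚ] K) * s = 1 := by exact_mod_cast congrArg Subtype.val hss
    have htt' : (t : K ≃ₐ[ℚ] K) * t = 1 := by exact_mod_cast congrArg Subtype.val htt
    have hs1' : (s : K ≃ₐ[ℚ] K) ≠ 1 := fun h => hs1 (Subtype.ext h)
    have ht1' : (t : K ≃ₐ[ℚ] K) ≠ 1 := fun h => ht1 (Subtype.ext h)
    rw [← ha, ← hb]
    refine hsame a b haA hbA ?_ ?_ ?_ ?_
    · rw [show a ^ 4 = a * a * (a * a) by simp only [pow_succ, pow_zero, one_mul, mul_assoc], ha]; exact hss'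
    · rw [ha]; exact hs1'
    · rw [show b ^ 4 = b * b * (b * b) by simp only [pow_succ, pow_zero, one_mul, mul_assoc], hb]; exact htt'
    · rw [hb]; exact ht1'
  /- Step 4: `R` is cyclic (not quaternion: it is commutative), generated by some `x²` with `x ∈ A` of order `2^(j+1)` -/
  have hRcomm : ∀ s t : R, s * t = t * s := fun s t => Subtype.ext (hcommA _ (hRA _ s.2) _ (hRA _ t.2))
  rcases UniqueInvolution.isCyclic_or_nonempty_mulEquiv_quaternionGroup (G := R) hj huniq with hcyc | ⟨hj3', ⟨e⟩⟩
  swap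
  · exact absurd hRcomm fun h => not_comm_of_mulEquiv_quaternionGroup
      (le_trans (by norm_num) (Nat.pow_le_pow_right (by norm_num) (by omega) : 2 ^ 1 ≤ 2 ^ (j - 2))) e h
  obtain ⟨yR, hyR⟩ := IsCyclic.exists_generator (α := R)
  have hoy : orderOf (yR : K ≃ₐ[ℚ] K) = 2 ^ j := by rw [Subgroup.orderOf_coe, orderOf_eq_card_of_forall_mem_zpowers hyR, hj]
  obtain ⟨x, hxA, hx⟩ := hRmem yR yR.2
  -- `orderOf x = 2^i` with `2^i / 2 = 2^j`, so `i = j + 1`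
  obtain ⟨i, -, hi⟩ := (Nat.dvd_prime_pow Nat.prime_two).1 (hcard ▸ orderOf_dvd_natCard x)
  have hx2 : orderOf (x ^ 2) = 2 ^ j := by rw [pow_two, hx, hoy]
  have hi1 : 1 ≤ i := by
    by_contra h0
    have : i = 0 := by omega
    rw [this, pow_zero, orderOf_eq_one_iff] at hi
    rw [hi, one_pow, orderOf_one] at hx2
    have : 2 ^ 3 ≤ 2 ^ j := Nat.pow_le_pow_right (by norm_num) (by omega)
    omega
  have hij : i = j + 1 := by
    have h1 : orderOf (x ^ 2) = orderOf x / 2 :=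
      orderOf_pow_of_dvd (by norm_num) (by rw [hi]; exact dvd_pow_self 2 (by omega))
    rw [hx2, hi, show 2 ^ i = 2 ^ (i - 1) * 2 by rw [← pow_succ, Nat.sub_add_cancel hi1], Nat.mul_div_cancel _ (by norm_num)] at h1
    have := Nat.pow_right_injective le_rfl h1
    omega
  -- `orderOf x ∣ |A| = 2^(n-1)`
  have hxdvd : orderOf x ∣ 2 ^ (n - 1) := by
    have := orderOf_dvd_natCard (⟨x, hxA⟩ : A)
    rw [Subgroup.orderOf_mk, hAcard] at this
    exact this
  rw [hi] at hxdvd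
  have hile : i ≤ n - 1 := (Nat.pow_dvd_pow_iff_le_right (by norm_num)).1 hxdvd
  -- `i ∈ {n-2, n-1}`
  by_cases hieq : i = n - 2
  · exact ⟨x, hxA, by rw [hi, hieq]⟩
  · have hin : i = n - 1 := by omega
    refine ⟨x ^ 2, A.pow_mem hxA 2, ?_⟩
    rw [hx2]
    congr 1
    omega

/-- **THE INDEX-TWO WORLD CLASSIFIED** (`[K:ℚ] = 2^n ≥ 128`, unconditional): `K` Galois CM, every primitive CM type nondegenerate, and
`Gal(K/ℚ)` has an ABELIAN subgroup of index `2` containing complex conjugation.  Then `Gal(K/ℚ) = H·E` with `H.IsComplement' E`, `E`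
central of exponent `2`, `|E| ≤ 2`, `c ∈ H ∖ E`, `H` cyclic or generalised quaternion — `Gal(K/ℚ)` is `C_{2^n}`, `Q_{2^n}`,
`C_{2^(n-1)} × C₂` (`c ∈ C`) or `Q_{2^(n-1)} × C₂` (`c ∈ Q`). [cite: Rotman1995, Thm. 5.46] [cite: Shimura1998, §8.2 Prop. 26 and §18.2]
[cite: Kubota1965, §2 and §4 Lemma 2] [cite: Gordon1999HodgeAVSurvey, §9.3 and §9.4.3] -/
theorem struct_of_index_two_abelian' {n : ℕ} (hdeg : Module.finrank ℚ K = 2 ^ n) (hn : 7 ≤ n)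
    (hgood : ∀ (Φ : CMType K) (φ : K →+* ℂ), IsPrimitive (ℂ ≃+* ℂ) Φ.1 φ → IsNondegenerate Φ)
    (A : Subgroup (K ≃ₐ[ℚ] K)) (hAidx : A.index = 2) (hcommA : ∀ u ∈ A, ∀ v ∈ A, u * v = v * u)
    (hcA : (IsCMField.complexConj K).restrictScalars ℚ ∈ A) :
    ∃ (H E : Subgroup (K ≃ₐ[ℚ] K)) (k : ℕ), H.IsComplement' E ∧ (IsCMField.complexConj K).restrictScalars ℚ ∈ H ∧
      (IsCMField.complexConj K).restrictScalars ℚ ∉ E ∧ (∀ e ∈ E, e * e = 1 ∧ ∀ x : K ≃ₐ[ℚ] K, x * e = e * x) ∧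
      Nat.card E ≤ 2 ∧ Nat.card H = 2 ^ k ∧ (IsCyclic H ∨ (3 ≤ k ∧ Nonempty (H ≃* QuaternionGroup (2 ^ (k - 2))))) := by
  obtain ⟨g, hgA, hg⟩ := exists_orderOf_eq_of_index_two_abelian hdeg (by omega) hgood A hAidx hcommA hcA
  exact struct_of_index_two_abelian hdeg hn hgood A hAidx hcommA hcA g hgA hg

/-- **… as an equivalence**: for `K` Galois CM of degree `2^n ≥ 128` whose Galois group has an abelian subgroup of index `2` containing
complex conjugation, every primitive CM type is nondegenerate **iff** `Gal(K/ℚ) = H·E` as above (`Gal ∈ {C, Q, C × C₂, Q × C₂}`).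
[cite: Rotman1995, Thm. 5.46] [cite: Kubota1965, §2 and §4 Lemma 2] [cite: Shimura1998, §8.2 Prop. 26 and §18.2] -/
theorem good_iff_struct_of_index_two_abelian' {n : ℕ} (hdeg : Module.finrank ℚ K = 2 ^ n) (hn : 7 ≤ n)
    (A : Subgroup (K ≃ₐ[ℚ] K)) (hAidx : A.index = 2) (hcommA : ∀ u ∈ A, ∀ v ∈ A, u * v = v * u)
    (hcA : (IsCMField.complexConj K).restrictScalars ℚ ∈ A) :
    (∀ (Φ : CMType K) (φ : K →+* ℂ), IsPrimitive (ℂ ≃+* ℂ) Φ.1 φ → IsNondegenerate Φ) ↔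
      ∃ (H E : Subgroup (K ≃ₐ[ℚ] K)) (k : ℕ), H.IsComplement' E ∧ (IsCMField.complexConj K).restrictScalars ℚ ∈ H ∧
        (IsCMField.complexConj K).restrictScalars ℚ ∉ E ∧ (∀ e ∈ E, e * e = 1 ∧ ∀ x : K ≃ₐ[ℚ] K, x * e = e * x) ∧
        Nat.card E ≤ 2 ∧ Nat.card H = 2 ^ k ∧ (IsCyclic H ∨ (3 ≤ k ∧ Nonempty (H ≃* QuaternionGroup (2 ^ (k - 2))))) := by
  refine ⟨fun hgood => struct_of_index_two_abelian' hdeg hn hgood A hAidx hcommA hcA, ?_⟩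
  rintro ⟨H, E, k, hHE, hcH, -, hE, hEcard, hHcard, hstruct⟩ Φ φ hprim
  exact isNondegenerate_of_isPrimitive_of_struct hdeg (by omega) H E k hHE hcH hE hEcard hHcard hstruct φ hprim

/-- **THE HODGE CONJECTURE in the index-two world** (`[K:ℚ] = 2^n ≥ 128`, unconditional): `K` Galois CM with every primitive CM type
nondegenerate and an abelian subgroup of index `2` in `Gal(K/ℚ)` containing complex conjugation; then HC holds for `⨁_{Fin N} X` for
every abelian variety `X` realising any CM type of `K`. [cite: Gordon1999HodgeAVSurvey, Thm. 6.4, §9.3 and §9.4.3]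
[cite: Shimura1998, §5.1 Prop. 3 and §8.2 Prop. 26] -/
theorem hodgeConjectureFor_pow_of_index_two_abelian' {n : ℕ} (hdeg : Module.finrank ℚ K = 2 ^ n) (hn : 7 ≤ n)
    (hgood : ∀ (Φ : CMType K) (φ : K →+* ℂ), IsPrimitive (ℂ ≃+* ℂ) Φ.1 φ → IsNondegenerate Φ)
    (A : Subgroup (K ≃ₐ[ℚ] K)) (hAidx : A.index = 2) (hcommA : ∀ u ∈ A, ∀ v ∈ A, u * v = v * u)
    (hcA : (IsCMField.complexConj K).restrictScalars ℚ ∈ A)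
    {Φ : CMType K} {X : AbelianVariety ℂ} {ι : 𝓞 K →+* End X} {θ : K →+* Module.End ℂ (complexBetti X.X 1)}
    (hX : Literature.AlgebraicGeometry.ComplexMultiplication.IsCMTypeRealisation Φ X ι θ) (N : ℕ) :
    HodgeConjectureFor (⨁ fun _ : Fin N => X).dim (⨁ fun _ : Fin N => X).X := by
  obtain ⟨H, E, k, hHE, hcH, -, hE, hEcard, hHcard, hstruct⟩ := struct_of_index_two_abelian' hdeg hn hgood A hAidx hcommA hcA
  exact hodgeConjectureFor_pow_of_struct hdeg (by omega) H E k hHE hcH hE hEcard hHcard hstruct hX N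

/-- **… for ANY abelian subgroup of index two** (`[K:ℚ] = 2^n ≥ 128`, unconditional): if `Gal(K/ℚ)` has an abelian subgroup `A` of
index `2` (containing complex conjugation or not — if not, `Gal(K/ℚ) = A × ⟨c⟩` is abelian and the abelian classification supplies a cyclic
subgroup of index `2` containing `c`), then every primitive CM type of `K` is nondegenerate **iff** `Gal(K/ℚ) = H·E` with
`H.IsComplement' E`, `E` central of exponent `2`, `|E| ≤ 2`, `c ∈ H ∖ E`, `H` cyclic or generalised quaternion.
[cite: Rotman1995, Thm. 5.46] [cite: Kubota1965, §4 Lemma 2] [cite: Gordon1999HodgeAVSurvey, §9.4.3] [cite: Shimura1998, §8.2 Prop. 26 and §18.2] -/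
theorem good_iff_struct_of_index_two_abelian_any {n : ℕ} (hdeg : Module.finrank ℚ K = 2 ^ n) (hn : 7 ≤ n)
    (A : Subgroup (K ≃ₐ[ℚ] K)) (hAidx : A.index = 2) (hcommA : ∀ u ∈ A, ∀ v ∈ A, u * v = v * u) :
    (∀ (Φ : CMType K) (φ : K →+* ℂ), IsPrimitive (ℂ ≃+* ℂ) Φ.1 φ → IsNondegenerate Φ) ↔
      ∃ (H E : Subgroup (K ≃ₐ[ℚ] K)) (k : ℕ), H.IsComplement' E ∧ (IsCMField.complexConj K).restrictScalars ℚ ∈ H ∧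
        (IsCMField.complexConj K).restrictScalars ℚ ∉ E ∧ (∀ e ∈ E, e * e = 1 ∧ ∀ x : K ≃ₐ[ℚ] K, x * e = e * x) ∧
        Nat.card E ≤ 2 ∧ Nat.card H = 2 ^ k ∧ (IsCyclic H ∨ (3 ≤ k ∧ Nonempty (H ≃* QuaternionGroup (2 ^ (k - 2))))) := by
  classical
  refine ⟨fun hgood => ?_, ?_⟩
  swap
  · rintro ⟨H, E, k, hHE, hcH, -, hE, hEcard, hHcard, hstruct⟩ Φ φ hprim
    exact isNondegenerate_of_isPrimitive_of_struct hdeg (by omega) H E k hHE hcH hE hEcard hHcard hstruct φ hprim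
  set c := (IsCMField.complexConj K).restrictScalars ℚ with hc
  by_cases hcA : c ∈ A
  · exact struct_of_index_two_abelian' hdeg hn hgood A hAidx hcommA hcA
  -- `c ∉ A`: `Gal(K/ℚ) = A ∪ A c` is abelian
  have hccen : ∀ x : K ≃ₐ[ℚ] K, x * c = c * x := fun x =>
    (model_complexConj_comm (MulEquiv.refl (K ≃ₐ[ℚ] K)) (by simp [hc]) x).symm
  have hcc : c * c = 1 := model_complexConj_mul_self (MulEquiv.refl (K ≃ₐ[ℚ] K)) (by simp [hc])
  have hform : ∀ g : K ≃ₐ[ℚ] K, g ∈ A ∨ g * c ∈ A := fun g => by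
    by_cases hg : g ∈ A
    · exact Or.inl hg
    · exact Or.inr ((Subgroup.mul_mem_iff_of_index_two hAidx).2 (iff_of_false hg hcA))
  have hcomm : ∀ g h : K ≃ₐ[ℚ] K, g * h = h * g := by
    -- reduce to `A`-parts: write `g = a` or `g = a c⁻¹`
    have key : ∀ g h : K ≃ₐ[ℚ] K, g ∈ A → (h ∈ A ∨ h * c ∈ A) → g * h = h * g := by
      intro g h hg hh
      rcases hh with hh | hh
      · exact hcommA g hg h hh
      · have e : h = (h * c) * c := by rw [mul_assoc, hcc, mul_one]
        rw [e]
        calc g * (h * c * c) = (g * (h * c)) * c := by group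
          _ = ((h * c) * g) * c := by rw [hcommA g hg (h * c) hh]
          _ = (h * c) * (g * c) := by group
          _ = (h * c) * (c * g) := by rw [hccen g]
          _ = h * c * c * g := by group
    intro g h
    rcases hform g with hg | hg
    · exact key g h hg (hform h)
    · have e : g = (g * c) * c := by rw [mul_assoc, hcc, mul_one]
      rw [e, mul_assoc, ← hccen h, ← mul_assoc, key (g * c) h hg (hform h), mul_assoc]
  -- the abelian classification: `c` lies in a cyclic subgroup `⟨z⟩` of index `≤ 2`
  obtain ⟨φ₀⟩ := (inferInstance : Nonempty (K →+* ℂ))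
  have hα := (AbelianTwoPowerClassification.forall_isPrimitive_isNondegenerate_iff hcomm (n := n - 1)
    (by rw [hdeg, Nat.sub_add_cancel (by omega)]) φ₀).1 (fun Φ hprim => hgood Φ φ₀ hprim)
  have h128 : 128 ≤ 2 ^ n := le_trans (by norm_num) (Nat.pow_le_pow_right (by norm_num) hn : 2 ^ 7 ≤ 2 ^ n)
  rcases hα with ⟨z, hcz, hidx⟩ | h8 | ⟨h16, -⟩
  · have hcard : Nat.card (K ≃ₐ[ℚ] K) = 2 ^ n := by
      rw [Nat.card_eq_fintype_card, card_model_eq_finrank (MulEquiv.refl (K ≃ₐ[ℚ] K)), hdeg]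
    -- an abelian subgroup `B` of index `2` containing `c`
    obtain ⟨B, hBidx, hcB⟩ : ∃ B : Subgroup (K ≃ₐ[ℚ] K), B.index = 2 ∧ c ∈ B := by
      have hidx0 : (Subgroup.zpowers z).index ≠ 0 := Subgroup.index_ne_zero_of_finite
      by_cases h2 : (Subgroup.zpowers z).index = 2
      · exact ⟨Subgroup.zpowers z, h2, hcz⟩
      · -- index `1`: `Gal = ⟨z⟩` is cyclic of order `2^n`; take `B = ⟨z²⟩`
        have h1 : (Subgroup.zpowers z).index = 1 := by omega
        have hoz : orderOf z = 2 ^ n := by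
          have := (Subgroup.zpowers z).index_mul_card
          rw [h1, one_mul, Nat.card_zpowers, hcard] at this
          exact this
        refine ⟨Subgroup.zpowers (z ^ 2), ?_, ?_⟩
        · have hoz2 : orderOf (z ^ 2) = 2 ^ (n - 1) := by
            rw [orderOf_pow_of_dvd (by norm_num) (by rw [hoz]; exact dvd_pow_self 2 (by omega)), hoz,
              show 2 ^ n = 2 ^ (n - 1) * 2 by rw [← pow_succ, Nat.sub_add_cancel (by omega)], Nat.mul_div_cancel _ (by norm_num)]
          have h3 := (Subgroup.zpowers (z ^ 2)).index_mul_card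
          rw [Nat.card_zpowers, hoz2, hcard, show 2 ^ n = 2 * 2 ^ (n - 1) by
            rw [← pow_succ', Nat.sub_add_cancel (by omega)]] at h3
          exact Nat.eq_of_mul_eq_mul_right (by positivity) h3
        · -- `c` is the involution of the cyclic group `⟨z⟩`, namely `z^(2^(n-1)) = (z²)^(2^(n-2))`
          have hc1 : c ≠ 1 := model_complexConj_ne_one (MulEquiv.refl (K ≃ₐ[ℚ] K)) (by simp [hc])
          obtain ⟨-, hcpow⟩ := eq_halfpower_of_mem_zpowers hoz hcz hcc hc1
          refine Subgroup.mem_zpowers_iff.2 ⟨(2 : ℤ) ^ (n - 2), ?_⟩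
          rw [← zpow_natCast z 2, ← zpow_mul]
          have e2 : ((2 : ℕ) : ℤ) * (2 : ℤ) ^ (n - 2) = (2 : ℤ) ^ (n - 1) := by
            push_cast
            rw [← pow_succ']
            congr 1
            omega
          rw [e2]
          exact hcpow.symm
    exact struct_of_index_two_abelian' hdeg hn hgood B hBidx (fun u _ v _ => hcomm u v) hcB
  · omega
  · omega

end Field

end Summit.HodgeConjecture.CorCM.GaloisModels
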